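import Literature.MathematicalPhysics.QuantumManyBody.LiebYngvasonTheorem
import HarnessLib

/-!
# A linear energy penalty for crowded Neumann cells

Topic `Literature/MathematicalPhysics/QuantumManyBody`, namespace `…BoseGas`; companion of
`LiebYngvasonTheorem.lean` (the Lieb–Yngvason lower bound `LSSY2005_lowerBound_neumann_holds`,
[LSSY2005, Thm. 2.4]) and of the superadditivity (2.53) of the Neumann cell energies
(`LSSY2005_superadditivity_holds`).  For a repulsive finite-range potential with positive (finite)
scattering length `a` there are a density `ρ_h = ρ_h(v) > 0`, a rate `P = 2πaρ_h` and a minimal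
cell size `ℓ₁` such that in every Neumann cell of side `ℓ ≥ ℓ₁` the energy of `n` particles is at
least `P · n` up to the offset `P · 2ρ_h ℓ³`:

* `exists_crowdedCell_penalty` — `ofReal (P n) ≤ E₀^Neu(n, ℓ) + ofReal (P · 2ρ_hℓ³)` for all `n`.
  Proof: with the threshold `m_h = ⌈ρ_h ℓ³⌉ ≤ 2ρ_hℓ³`, cells with `n ≤ m_h` are covered by the
  offset; for `n > m_h` superadditivity gives `E₀^Neu(n, ℓ) ≥ ⌊n/m_h⌋ E₀^Neu(m_h, ℓ)`, the
  Lieb–Yngvason bound at density `m_h/ℓ³ ∈ [ρ_h, 2ρ_h]` (dilute by the choice of `ρ_h`, the cell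
  being large by the choice of `ℓ₁`) gives `E₀^Neu(m_h, ℓ) ≥ 2πa m_h²/ℓ³ ≥ P m_h`, and
  `⌊n/m_h⌋ m_h ≥ n - m_h`.
* `ofReal_mul_sum_le_sum_add_card_mul` — summed over a finite set of cells:
  `ofReal (P ∑_c n_c) ≤ ∑_c E₀^Neu(n_c, ℓ) + #cells · ofReal (P · 2ρ_hℓ³)`.

This is the mechanism by which a thin boundary layer cannot hold a positive fraction of the
particles of a dilute gas at bounded energy cost per particle. No definitions.

## References

* [LSSY2005] E. H. Lieb, R. Seiringer, J. P. Solovej, J. Yngvason, *The Mathematics of the Bose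
  Gas and its Condensation*, Oberwolfach Seminars 34, Birkhäuser 2005 (arXiv:cond-mat/0610117):
  Thm. 2.4 (2.35) and (2.53).
* [LiebYngvason1998] E. H. Lieb, J. Yngvason, *Ground state energy of the low density Bose gas*,
  Phys. Rev. Lett. 80 (1998) 2504–2507.
-/

noncomputable section

open MeasureTheory Filter
open scoped ENNReal NNReal

namespace Literature.MathematicalPhysics.QuantumManyBody.BoseGas

/-- Floor division recovers all but one block: `n - p ≤ ⌊n/p⌋ · p` in `ℝ` for naturals, `p > 0`. [folklore] -/
theorem sub_le_nat_div_mul (n : ℕ) {p : ℕ} (hp : 0 < p) : (n : ℝ) - p ≤ ((n / p : ℕ) : ℝ) * p := by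
  have hdm := Nat.div_add_mod n p
  have hmod : n % p < p := Nat.mod_lt _ hp
  have h1 : (n : ℝ) = p * ((n / p : ℕ) : ℝ) + ((n % p : ℕ) : ℝ) := by exact_mod_cast hdm.symm
  have h2 : ((n % p : ℕ) : ℝ) ≤ p := by exact_mod_cast hmod.le
  nlinarith

/-- **A linear energy penalty for crowded Neumann cells.**  For a repulsive finite-range `v` with
scattering length `0 < a < ∞` there are `P > 0`, `ρ_h > 0` and `ℓ₁ > 0` (depending only on `v`;
`P = 2πaρ_h`) such that for every cell side `ℓ ≥ ℓ₁` and every particle number `n`,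
`ofReal (P n) ≤ E₀^Neu(n, ℓ) + ofReal (P · 2ρ_h ℓ³)`: beyond the threshold occupation
`⌈ρ_hℓ³⌉ ≤ 2ρ_hℓ³` every particle costs at least `P` (superadditivity (2.53) down to the
threshold, where the Lieb–Yngvason bound Thm. 2.4 applies). [cite: LSSY2005, Thm. 2.4 and (2.53)] -/
theorem exists_crowdedCell_penalty {v : ℝ → ℝ≥0∞} (hv : IsRepulsiveFiniteRange v)
    (hfin : scatteringLength v ≠ ⊤) (hapos : 0 < scatteringLength v) :
    ∃ P ρh ℓ₁ : ℝ, 0 < P ∧ 0 < ρh ∧ 0 < ℓ₁ ∧ P = 2 * Real.pi * (scatteringLength v).toReal * ρh ∧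
      ∀ ℓ : ℝ, ℓ₁ ≤ ℓ → ∀ n : ℕ,
        ENNReal.ofReal (P * n) ≤
          neumannGroundStateEnergy v n ℓ + ENNReal.ofReal (P * (2 * ρh * ℓ ^ 3)) := by
  set a : ℝ := (scatteringLength v).toReal with ha_def
  have ha : 0 < a := ENNReal.toReal_pos hapos.ne' hfin
  obtain ⟨δ₂, C₂, C₂', hδ₂, hC₂, hC₂', HLY⟩ := LSSY2005_lowerBound_neumann_holds v hv hfin
  -- the threshold density: `Y(2ρ_h) = min (δ₂/2) ((2C₂)⁻¹)^17`
  set Yt : ℝ := min (δ₂ / 2) ((2 * C₂)⁻¹ ^ (17 : ℕ)) with hYt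
  have hYt0 : 0 < Yt := lt_min (by positivity) (by positivity)
  set ρh : ℝ := 3 * Yt / (8 * Real.pi * a ^ 3) with hρh_def
  have hρh : 0 < ρh := by positivity
  set P : ℝ := 2 * Real.pi * a * ρh with hP_def
  have hP : 0 < P := by positivity
  -- the minimal cell: `ℓ ≥ 1`, `ρ_h ℓ ≥ 1`, and the Lieb–Yngvason size condition at density `ρ_h`
  set Y₁ : ℝ := 4 * Real.pi * ρh * a ^ 3 / 3 with hY₁
  have hY₁0 : 0 < Y₁ := by positivity
  set ℓ₁ : ℝ := max (max 1 ρh⁻¹) (a * (C₂' * Y₁ ^ (-(6 : ℝ) / 17)) + 1) with hℓ₁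
  have hℓ₁ : 0 < ℓ₁ := lt_of_lt_of_le one_pos ((le_max_left _ _).trans (le_max_left _ _))
  refine ⟨P, ρh, ℓ₁, hP, hρh, hℓ₁, rfl, fun ℓ hℓ n => ?_⟩
  have hℓ1 : 1 ≤ ℓ := ((le_max_left _ _).trans (le_max_left _ _)).trans hℓ
  have hℓ0 : 0 < ℓ := one_pos.trans_le hℓ1
  have hℓρ : ρh⁻¹ ≤ ℓ := ((le_max_right _ _).trans (le_max_left _ _)).trans hℓ
  have hℓC : a * (C₂' * Y₁ ^ (-(6 : ℝ) / 17)) + 1 ≤ ℓ := (le_max_right _ _).trans hℓ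
  -- the threshold occupation
  set mth : ℕ := ⌈ρh * ℓ ^ 3⌉₊ with hmth
  have hρℓ3 : 1 ≤ ρh * ℓ ^ 3 := by
    have h1 : 1 ≤ ρh * ℓ := by
      rw [inv_le_iff_one_le_mul₀ hρh] at hℓρ; linarith [hℓρ]
    have h2 : ℓ ≤ ℓ ^ 3 := by
      calc ℓ = ℓ * 1 * 1 := by ring
        _ ≤ ℓ * ℓ * ℓ := by gcongr
        _ = ℓ ^ 3 := by ring
    calc (1 : ℝ) ≤ ρh * ℓ := h1
      _ ≤ ρh * ℓ ^ 3 := mul_le_mul_of_nonneg_left h2 hρh.le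
  have hmth1 : ρh * ℓ ^ 3 ≤ mth := Nat.le_ceil _
  have hmth2 : (mth : ℝ) ≤ 2 * (ρh * ℓ ^ 3) := by
    have := Nat.ceil_lt_add_one (show 0 ≤ ρh * ℓ ^ 3 by positivity)
    rw [← hmth] at this
    linarith
  have hmthpos : 0 < mth := by
    have : (0 : ℝ) < mth := lt_of_lt_of_le (by positivity) hmth1
    exact_mod_cast this
  have hmthr : (0 : ℝ) < mth := by exact_mod_cast hmthpos
  -- the cell density at the threshold and its `Y`
  set Yc : ℝ := 4 * Real.pi * ((mth : ℝ) / ℓ ^ 3) * a ^ 3 / 3 with hYc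
  have hρc1 : ρh ≤ (mth : ℝ) / ℓ ^ 3 := by rw [le_div_iff₀ (by positivity)]; exact hmth1
  have hρc2 : (mth : ℝ) / ℓ ^ 3 ≤ 2 * ρh := by
    rw [div_le_iff₀ (by positivity)]; linarith
  have hYc1 : Y₁ ≤ Yc := by
    rw [hY₁, hYc]
    have : 4 * Real.pi * ρh * a ^ 3 / 3 = 4 * Real.pi * ρh * (a ^ 3 / 3) := by ring
    rw [this, show 4 * Real.pi * ((mth : ℝ) / ℓ ^ 3) * a ^ 3 / 3 =
      4 * Real.pi * ((mth : ℝ) / ℓ ^ 3) * (a ^ 3 / 3) by ring]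
    gcongr
  have hYc2 : Yc ≤ Yt := by
    calc Yc ≤ 4 * Real.pi * (2 * ρh) * a ^ 3 / 3 := by rw [hYc]; gcongr
      _ = Yt := by rw [hρh_def]; field_simp; norm_num
  have hYc0 : 0 < Yc := hY₁0.trans_le hYc1
  -- the Lieb–Yngvason hypotheses in the cell
  have hYδ : Yc < δ₂ := lt_of_le_of_lt (hYc2.trans (min_le_left _ _)) (by linarith)
  have hCY : C₂ * Yc ^ ((1 : ℝ) / 17) ≤ 1 / 2 := by
    have h1 : Yc ^ ((1 : ℝ) / 17) ≤ ((2 * C₂)⁻¹ ^ (17 : ℕ)) ^ ((1 : ℝ) / 17) :=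
      Real.rpow_le_rpow hYc0.le (hYc2.trans (min_le_right _ _)) (by norm_num)
    have h2 : ((2 * C₂)⁻¹ ^ (17 : ℕ)) ^ ((1 : ℝ) / 17) = (2 * C₂)⁻¹ := by
      rw [← Real.rpow_natCast, ← Real.rpow_mul (by positivity)]
      norm_num
    rw [h2] at h1
    calc C₂ * Yc ^ ((1 : ℝ) / 17) ≤ C₂ * (2 * C₂)⁻¹ := mul_le_mul_of_nonneg_left h1 hC₂.le
      _ = 1 / 2 := by field_simp
  have hsize : C₂' * Yc ^ (-(6 : ℝ) / 17) < ℓ / a := by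
    have h1 : Yc ^ (-(6 : ℝ) / 17) ≤ Y₁ ^ (-(6 : ℝ) / 17) :=
      Real.rpow_le_rpow_of_nonpos hY₁0 hYc1 (by norm_num)
    rw [lt_div_iff₀ ha]
    calc C₂' * Yc ^ (-(6 : ℝ) / 17) * a ≤ C₂' * Y₁ ^ (-(6 : ℝ) / 17) * a := by gcongr
      _ < ℓ := by nlinarith
  have hLY : ENNReal.ofReal (4 * Real.pi * ((mth : ℝ) / ℓ ^ 3) * a *
      (1 - C₂ * Yc ^ ((1 : ℝ) / 17)) * mth) ≤ neumannGroundStateEnergy v mth ℓ :=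
    HLY mth ℓ hℓ0 hYδ hsize
  -- the energy at the threshold is at least `P · mth`
  have hLYP : P * mth ≤ 4 * Real.pi * ((mth : ℝ) / ℓ ^ 3) * a * (1 - C₂ * Yc ^ ((1 : ℝ) / 17)) * mth := by
    have h1 : (1 : ℝ) / 2 ≤ 1 - C₂ * Yc ^ ((1 : ℝ) / 17) := by linarith
    calc P * mth = 4 * Real.pi * ρh * a * (1 / 2) * mth := by rw [hP_def]; ring
      _ ≤ 4 * Real.pi * ((mth : ℝ) / ℓ ^ 3) * a * (1 - C₂ * Yc ^ ((1 : ℝ) / 17)) * mth := by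
          gcongr
  have hthr : ENNReal.ofReal (P * mth) ≤ neumannGroundStateEnergy v mth ℓ :=
    (ENNReal.ofReal_le_ofReal hLYP).trans hLY
  -- the offset covers `P · mth`
  have hoff : P * mth ≤ P * (2 * ρh * ℓ ^ 3) := by
    rw [show 2 * ρh * ℓ ^ 3 = 2 * (ρh * ℓ ^ 3) by ring]
    exact mul_le_mul_of_nonneg_left hmth2 hP.le
  rcases le_or_gt n mth with hn | hn
  · -- few particles: the offset alone suffices
    calc ENNReal.ofReal (P * n) ≤ ENNReal.ofReal (P * (2 * ρh * ℓ ^ 3)) := by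
          refine ENNReal.ofReal_le_ofReal (le_trans ?_ hoff)
          exact mul_le_mul_of_nonneg_left (by exact_mod_cast hn) hP.le
      _ ≤ _ := le_add_self
  · -- crowded: superadditivity down to the threshold
    have hsup := LSSY2005_superadditivity_holds.mul_le hv.1 hℓ0 mth (n / mth) (n % mth)
    rw [Nat.div_add_mod'] at hsup
    have hq : ENNReal.ofReal (P * ((n : ℝ) - mth)) ≤ neumannGroundStateEnergy v n ℓ := by
      calc ENNReal.ofReal (P * ((n : ℝ) - mth))
          ≤ ENNReal.ofReal (((n / mth : ℕ) : ℝ) * (P * mth)) := by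
            refine ENNReal.ofReal_le_ofReal ?_
            have := sub_le_nat_div_mul n hmthpos
            nlinarith
        _ = ((n / mth : ℕ) : ℝ≥0∞) * ENNReal.ofReal (P * mth) := by
            rw [ENNReal.ofReal_mul (Nat.cast_nonneg _), ENNReal.ofReal_natCast]
        _ ≤ ((n / mth : ℕ) : ℝ≥0∞) * neumannGroundStateEnergy v mth ℓ := by gcongr
        _ ≤ neumannGroundStateEnergy v n ℓ := hsup
    calc ENNReal.ofReal (P * n) = ENNReal.ofReal (P * ((n : ℝ) - mth) + P * mth) := by ring_nf
      _ ≤ ENNReal.ofReal (P * ((n : ℝ) - mth)) + ENNReal.ofReal (P * mth) := ENNReal.ofReal_add_le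
      _ ≤ neumannGroundStateEnergy v n ℓ + ENNReal.ofReal (P * (2 * ρh * ℓ ^ 3)) :=
          add_le_add hq (ENNReal.ofReal_le_ofReal hoff)

/-- **The penalty summed over cells**: if `ofReal (P n) ≤ E(n) + ofReal B` for every `n`
(`P, B ≥ 0`), then for occupation numbers `n_c` of a finite set `T` of cells,
`ofReal (P ∑_{c∈T} n_c) ≤ ∑_{c∈T} E(n_c) + #T · ofReal B`. [folklore] -/
theorem ofReal_mul_sum_le_sum_add_card_mul {ι : Type*} (T : Finset ι) (n : ι → ℕ)
    (E : ℕ → ℝ≥0∞) {P B : ℝ} (hP : 0 ≤ P)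
    (h : ∀ m : ℕ, ENNReal.ofReal (P * m) ≤ E m + ENNReal.ofReal B) :
    ENNReal.ofReal (P * ∑ c ∈ T, (n c : ℝ)) ≤ (∑ c ∈ T, E (n c)) + T.card * ENNReal.ofReal B := by
  classical
  rw [Finset.mul_sum, ENNReal.ofReal_sum_of_nonneg fun c _ => by positivity]
  calc ∑ c ∈ T, ENNReal.ofReal (P * n c) ≤ ∑ c ∈ T, (E (n c) + ENNReal.ofReal B) :=
        Finset.sum_le_sum fun c _ => h (n c)
    _ = (∑ c ∈ T, E (n c)) + T.card * ENNReal.ofReal B := by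
        rw [Finset.sum_add_distrib, Finset.sum_const, nsmul_eq_mul]

end Literature.MathematicalPhysics.QuantumManyBody.BoseGas

end
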